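import Mathlib
import Literature.Geometry.Lorentzian.KerrSchildCoord
import Literature.Geometry.Lorentzian.KerrConvergence
import Literature.Geometry.Lorentzian.KerrSchildNullBicharacteristic
import Summits.FinalStateConjecture.FinalStateConjecture.Theorems.EIHFluxBalanceInertialRecessionLorentz

/-!
# Route ClusterCompleteness — `RecedingDopplerBudget`: the patched multi-Kerr coefficient field

Helper file for the support item `stmt-FinalStateConjecture-15025`
(`Summit.FinalStateConjecture.FinalStateConjecture.Theses.ClusterCompleteness.RecedingDopplerBudget`).

Pointwise facts about the item's inline inverse-metric field
`G^{μν}(x) = η^{μν} − ∑ᵢ χᵢ(x) 2Hᵢ(qᵢ x) (Λᵢ ℓ♯ᵢ(qᵢ x))^μ (Λᵢ ℓ♯ᵢ(qᵢ x))^ν`,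
`χᵢ = smoothTransition(2 − rᵢ/8Mᵢ)`, `qᵢ x = Λᵢ⁻¹(x − (0, pᵢ))`:

* the coefficients `χᵢ 2Hᵢ` are nonnegative and vanish where `rᵢ ≥ 16Mᵢ` (`coeff_eq_zero_of_le`);
  the boosted null vectors `Λᵢ ℓ♯ᵢ` are `η`-null (`minkowski_boosted_nullVector`);
* `G` is smooth where all `rᵢ ∘ qᵢ > 0` (`contDiffAt_field`) and has ZERO derivative at every point
  with all `rᵢ ≥ 16Mᵢ` (`hasFDerivAt_field_zero_of_flat`, since `smoothTransition` has a global
  minimum at every `z ≤ 0`), where it equals `η⁻¹` (`field_eq_minkowski_of_flat`);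
* near any point off the other holes' closed zones `{rⱼ ≤ 16Mⱼ}`, `G` agrees with the
  single-centre field of hole `k` (`eventually_eq_single`), which is invariant under translation by
  `u_k = Λ_k e₀` (`single_add_smul`); whence `∂_{u_k} G = 0` there
  (`fderiv_field_apply_u_eq_zero`) — the Killing energy `−ξ(u_k)` is conserved off the other zones.
-/

noncomputable section

open Literature.Geometry.Lorentzian Set Filter
open scoped Topology

namespace Summit.FinalStateConjecture.FinalStateConjecture.Theorems.RecedingDoppler

/-! ### The concrete patched field: coefficients, null vectors, smoothness, flat derivative -/

section Field

variable {N : ℕ} {M a : Fin N → ℝ} {Λ : Fin N → lorentzGroup} {p : Fin N → E3} {u : Fin N → E4}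
  {q : Fin N → E4 → E4} {G : E4 → Fin 4 → Fin 4 → ℝ}

/-- The attenuated Kerr–Schild coefficient `χᵢ · 2Hᵢ ≥ 0` for `Mᵢ ≥ 0`
(`smoothTransition ≥ 0`, `H ≥ 0`: Visser arXiv:0706.0622, (33)). [folklore] -/
theorem coeff_nonneg {Mi ai : ℝ} (hM : 0 ≤ Mi) (y : E4) :
    0 ≤ Real.smoothTransition (2 - Kerr.radius ai y / (8 * Mi)) * (2 * Kerr.scalarH Mi ai y) :=
  mul_nonneg (Real.smoothTransition.nonneg _)
    (mul_nonneg zero_le_two (Kerr.scalarH_nonneg hM ai y))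

/-- **Tails cut at `r = 16M`**: the attenuation `χ = smoothTransition(2 − r/8M)` vanishes where
`r ≥ 16M` (`smoothTransition` is `0` on `(−∞, 0]`). [folklore] -/
theorem cutoff_eq_zero_of_le {Mi ai : ℝ} (hM : 0 < Mi) {y : E4} (h : 16 * Mi ≤ Kerr.radius ai y) :
    Real.smoothTransition (2 - Kerr.radius ai y / (8 * Mi)) = 0 := by
  apply Real.smoothTransition.zero_of_nonpos
  rw [sub_nonpos, le_div_iff₀ (by positivity)]
  linarith

/-- The coefficient `χᵢ · 2Hᵢ` vanishes where `rᵢ ≥ 16Mᵢ`. [folklore] -/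
theorem coeff_eq_zero_of_le {Mi ai : ℝ} (hM : 0 < Mi) {y : E4} (h : 16 * Mi ≤ Kerr.radius ai y) :
    Real.smoothTransition (2 - Kerr.radius ai y / (8 * Mi)) * (2 * Kerr.scalarH Mi ai y) = 0 := by
  rw [cutoff_eq_zero_of_le hM h, zero_mul]

/-- An active coefficient forces `rᵢ < 16Mᵢ` (contrapositive of `coeff_eq_zero_of_le`). [folklore] -/
theorem radius_lt_of_coeff_ne_zero {Mi ai : ℝ} (hM : 0 < Mi) {y : E4}
    (h : Real.smoothTransition (2 - Kerr.radius ai y / (8 * Mi)) * (2 * Kerr.scalarH Mi ai y) ≠ 0) :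
    Kerr.radius ai y < 16 * Mi := by
  by_contra hle
  exact h (coeff_eq_zero_of_le hM (not_lt.mp hle))

/-- **The boosted Kerr–Schild vector `Λ ℓ♯` is `η`-null** wherever `r > 0` (Lorentz invariance of
`η` and `η(ℓ♯, ℓ♯) = ℓ(ℓ♯) = 0`; Kerr–Schild 1965, §2). [folklore] -/
theorem minkowski_boosted_nullVector (Λi : lorentzGroup) {ai : ℝ} {y : E4}
    (hy : 0 < Kerr.radius ai y) :
    Minkowski.bilin ((Λi : E4 ≃L[ℝ] E4) (Kerr.nullVector ai y))
      ((Λi : E4 ≃L[ℝ] E4) (Kerr.nullVector ai y)) = 0 := by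
  rw [Λi.2, Kerr.bilin_nullVector, Kerr.nullCovector_nullVector hy]

/-- The inverse Poincaré map `x ↦ Λ⁻¹(x − c)` is smooth (affine). [folklore] -/
theorem contDiff_poincareInv' (Λi : lorentzGroup) (ci : E4) {n : WithTop ℕ∞} :
    ContDiff ℝ n (poincareInv Λi ci) :=
  ((Λi : E4 ≃L[ℝ] E4).symm.contDiff).comp (contDiff_id.sub contDiff_const)

/-- **Smoothness of one attenuated boosted Kerr–Schild term** `y ↦ χᵢ 2Hᵢ (Λᵢℓ♯ᵢ)^μ (Λᵢℓ♯ᵢ)^ν`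
(all evaluated at `qᵢ y = Λᵢ⁻¹(y − (0, pᵢ))`) at every point with `rᵢ(qᵢ y) > 0`
(`Kerr.contDiffAt_radius/scalarH/nullVector` of `KerrSchildCoord.lean`; Visser (33)–(35)).
[folklore] -/
theorem contDiffAt_term {Mi ai : ℝ} (Λi : lorentzGroup) (pi : E3) {qi : E4 → E4}
    (hq : ∀ x, qi x = poincareInv Λi (E4.ofTimeSpace 0 pi) x) {x : E4}
    (hx : 0 < Kerr.radius ai (qi x)) (μ ν : Fin 4) {n : ℕ∞} :
    ContDiffAt ℝ n (fun y ↦ Real.smoothTransition (2 - Kerr.radius ai (qi y) / (8 * Mi)) *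
      (2 * Kerr.scalarH Mi ai (qi y)) * ((Λi : E4 ≃L[ℝ] E4) (Kerr.nullVector ai (qi y))) μ *
        ((Λi : E4 ≃L[ℝ] E4) (Kerr.nullVector ai (qi y))) ν) x := by
  have hqf : qi = poincareInv Λi (E4.ofTimeSpace 0 pi) := funext hq
  have hqd : ContDiffAt ℝ n qi x := by
    rw [hqf]; exact (contDiff_poincareInv' Λi _).contDiffAt
  have hr : ContDiffAt ℝ n (fun y ↦ Kerr.radius ai (qi y)) x :=
    (Kerr.contDiffAt_radius hx).comp x hqd
  have hχ : ContDiffAt ℝ n (fun y ↦ Real.smoothTransition (2 - Kerr.radius ai (qi y) / (8 * Mi))) x :=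
    Real.smoothTransition.contDiff.contDiffAt.comp x ((contDiffAt_const.sub (hr.div_const _)))
  have hH : ContDiffAt ℝ n (fun y ↦ 2 * Kerr.scalarH Mi ai (qi y)) x :=
    contDiffAt_const.mul ((Kerr.contDiffAt_scalarH Mi ai hx).comp x hqd)
  have hL : ∀ κ, ContDiffAt ℝ n (fun y ↦ ((Λi : E4 ≃L[ℝ] E4) (Kerr.nullVector ai (qi y))) κ) x := by
    intro κ
    have h1 : ContDiffAt ℝ n (fun y ↦ (Λi : E4 ≃L[ℝ] E4) (Kerr.nullVector ai (qi y))) x :=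
      ((Λi : E4 ≃L[ℝ] E4).contDiff.contDiffAt).comp x
        ((Kerr.contDiffAt_nullVector ai hx).comp x hqd)
    exact (Kerr.contDiff_coord κ).contDiffAt.comp x h1
  exact ((hχ.mul hH).mul (hL μ)).mul (hL ν)

/-- **The patched field is smooth off the rest-frame origins**: every component `G^{μν}` is
`C^n` at any point where all `rᵢ(qᵢ x) > 0` (in particular outside the horizons). [folklore] -/
theorem contDiffAt_field
    (hq : ∀ i x, q i x = poincareInv (Λ i) (E4.ofTimeSpace 0 (p i)) x)
    (hG : ∀ x μ ν, G x μ ν = Minkowski.bilin (E4.basisVector μ) (E4.basisVector ν) -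
      ∑ i, Real.smoothTransition (2 - Kerr.radius (a i) (q i x) / (8 * M i)) *
        (2 * Kerr.scalarH (M i) (a i) (q i x)) *
        ((Λ i : E4 ≃L[ℝ] E4) (Kerr.nullVector (a i) (q i x))) μ *
        ((Λ i : E4 ≃L[ℝ] E4) (Kerr.nullVector (a i) (q i x))) ν)
    {x : E4} (hx : ∀ i, 0 < Kerr.radius (a i) (q i x)) (μ ν : Fin 4) {n : ℕ∞} :
    ContDiffAt ℝ n (fun y ↦ G y μ ν) x := by
  have hfun : (fun y ↦ G y μ ν) = fun y ↦
      Minkowski.bilin (E4.basisVector μ) (E4.basisVector ν) -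
      ∑ i, Real.smoothTransition (2 - Kerr.radius (a i) (q i y) / (8 * M i)) *
        (2 * Kerr.scalarH (M i) (a i) (q i y)) *
        ((Λ i : E4 ≃L[ℝ] E4) (Kerr.nullVector (a i) (q i y))) μ *
        ((Λ i : E4 ≃L[ℝ] E4) (Kerr.nullVector (a i) (q i y))) ν := funext fun y ↦ hG y μ ν
  rw [hfun]
  refine contDiffAt_const.sub ?_
  refine ContDiffAt.sum fun i _ ↦ ?_
  exact contDiffAt_term (Λ i) (p i) (hq i) (hx i) μ ν

/-- `smoothTransition` has derivative `0` at every `z ≤ 0` (it vanishes on `(−∞, 0]` and is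
nonnegative, so every such `z` is a global minimum of a differentiable function). [folklore] -/
theorem hasDerivAt_smoothTransition_zero {z : ℝ} (hz : z ≤ 0) :
    HasDerivAt Real.smoothTransition 0 z := by
  have hd : HasDerivAt Real.smoothTransition (deriv Real.smoothTransition z) z :=
    ((Real.smoothTransition.contDiff (n := 1)).differentiable one_ne_zero z).hasDerivAt
  have hmin : IsLocalMin Real.smoothTransition z := by
    refine Filter.Eventually.of_forall fun y ↦ ?_
    rw [Real.smoothTransition.zero_of_nonpos hz]
    exact Real.smoothTransition.nonneg y
  rwa [hmin.deriv_eq_zero] at hd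

/-- **One attenuated term has zero derivative where its tail is cut**: at a point with
`rᵢ(qᵢ x) ≥ 16Mᵢ` (so `rᵢ > 0`) the term `χᵢ 2Hᵢ (Λᵢℓ♯ᵢ)^μ (Λᵢℓ♯ᵢ)^ν` has Fréchet derivative
`0` — `χᵢ(x) = 0` and `dχᵢ(x) = 0`. [folklore] -/
theorem hasFDerivAt_term_zero {Mi ai : ℝ} (hM : 0 < Mi) (Λi : lorentzGroup) (pi : E3)
    {qi : E4 → E4} (hq : ∀ x, qi x = poincareInv Λi (E4.ofTimeSpace 0 pi) x) {x : E4}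
    (hx : 16 * Mi ≤ Kerr.radius ai (qi x)) (μ ν : Fin 4) :
    HasFDerivAt (fun y ↦ Real.smoothTransition (2 - Kerr.radius ai (qi y) / (8 * Mi)) *
      (2 * Kerr.scalarH Mi ai (qi y)) * ((Λi : E4 ≃L[ℝ] E4) (Kerr.nullVector ai (qi y))) μ *
        ((Λi : E4 ≃L[ℝ] E4) (Kerr.nullVector ai (qi y))) ν) (0 : E4 →L[ℝ] ℝ) x := by
  have hpos : 0 < Kerr.radius ai (qi x) := lt_of_lt_of_le (by positivity) hx
  have hqf : qi = poincareInv Λi (E4.ofTimeSpace 0 pi) := funext hq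
  have hqd : DifferentiableAt ℝ qi x := by
    rw [hqf]; exact ((contDiff_poincareInv' Λi _ (n := 1)).differentiable one_ne_zero) x
  -- the cutoff `χ` and the rest `g`
  set χ : E4 → ℝ := fun y ↦ Real.smoothTransition (2 - Kerr.radius ai (qi y) / (8 * Mi)) with hχ
  set g : E4 → ℝ := fun y ↦ (2 * Kerr.scalarH Mi ai (qi y)) *
    ((Λi : E4 ≃L[ℝ] E4) (Kerr.nullVector ai (qi y))) μ *
      ((Λi : E4 ≃L[ℝ] E4) (Kerr.nullVector ai (qi y))) ν with hg
  have hfun : (fun y ↦ Real.smoothTransition (2 - Kerr.radius ai (qi y) / (8 * Mi)) *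
      (2 * Kerr.scalarH Mi ai (qi y)) * ((Λi : E4 ≃L[ℝ] E4) (Kerr.nullVector ai (qi y))) μ *
        ((Λi : E4 ≃L[ℝ] E4) (Kerr.nullVector ai (qi y))) ν) = fun y ↦ χ y * g y := by
    funext y; simp only [hχ, hg]; ring
  rw [hfun]
  -- `dχ(x) = 0`
  have hqc : ContDiffAt ℝ 1 qi x := by
    rw [hqf]; exact (contDiff_poincareInv' Λi _).contDiffAt
  have hφc : ContDiffAt ℝ 1 (fun y ↦ 2 - Kerr.radius ai (qi y) / (8 * Mi)) x :=
    contDiffAt_const.sub (((Kerr.contDiffAt_radius hpos).comp x hqc).div_const _)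
  have hφ : DifferentiableAt ℝ (fun y ↦ 2 - Kerr.radius ai (qi y) / (8 * Mi)) x :=
    hφc.differentiableAt one_ne_zero
  have hz : 2 - Kerr.radius ai (qi x) / (8 * Mi) ≤ 0 := by
    rw [sub_nonpos, le_div_iff₀ (by positivity)]; linarith
  have hχd : HasFDerivAt χ (0 : E4 →L[ℝ] ℝ) x := by
    have h := (hasDerivAt_smoothTransition_zero hz).comp_hasFDerivAt x hφ.hasFDerivAt
    rw [zero_smul] at h
    exact h
  have hχ0 : χ x = 0 := by
    simp only [hχ]; exact Real.smoothTransition.zero_of_nonpos hz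
  -- `g` differentiable
  have hgd : DifferentiableAt ℝ g x := by
    have h := (contDiffAt_term (Mi := Mi) Λi pi hq hpos μ ν (n := 1)).differentiableAt one_ne_zero
    -- `g = χ'·…`-free factorisation: differentiate the three smooth factors directly
    have hH : DifferentiableAt ℝ (fun y ↦ 2 * Kerr.scalarH Mi ai (qi y)) x :=
      (differentiableAt_const _).mul
        (((Kerr.contDiffAt_scalarH Mi ai hpos (n := 1)).differentiableAt one_ne_zero).comp x hqd)
    have hL : ∀ κ, DifferentiableAt ℝ
        (fun y ↦ ((Λi : E4 ≃L[ℝ] E4) (Kerr.nullVector ai (qi y))) κ) x := by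
      intro κ
      have h1 : DifferentiableAt ℝ (fun y ↦ (Λi : E4 ≃L[ℝ] E4) (Kerr.nullVector ai (qi y))) x :=
        ((Λi : E4 ≃L[ℝ] E4).differentiableAt).comp x
          (((Kerr.contDiffAt_nullVector ai hpos (n := 1)).differentiableAt one_ne_zero).comp x hqd)
      exact ((Kerr.contDiff_coord κ (n := 1)).differentiable one_ne_zero _).comp x h1
    clear h
    simp only [hg]
    exact (hH.mul (hL μ)).mul (hL ν)
  have h := hχd.mul hgd.hasFDerivAt
  rw [hχ0, zero_smul, zero_add, smul_zero] at h
  exact h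

/-- **The patched field has ZERO derivative at every point of the exactly flat region
`{∀ i, rᵢ ≥ 16Mᵢ}`** — including its boundary: all momenta of a bicharacteristic are conserved there
(`KerrSchild.IsBicharacteristicOn.hasDerivAt_momentum_zero`). [folklore] -/
theorem hasFDerivAt_field_zero_of_flat (hM : ∀ i, 0 < M i)
    (hq : ∀ i x, q i x = poincareInv (Λ i) (E4.ofTimeSpace 0 (p i)) x)
    (hG : ∀ x μ ν, G x μ ν = Minkowski.bilin (E4.basisVector μ) (E4.basisVector ν) -
      ∑ i, Real.smoothTransition (2 - Kerr.radius (a i) (q i x) / (8 * M i)) *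
        (2 * Kerr.scalarH (M i) (a i) (q i x)) *
        ((Λ i : E4 ≃L[ℝ] E4) (Kerr.nullVector (a i) (q i x))) μ *
        ((Λ i : E4 ≃L[ℝ] E4) (Kerr.nullVector (a i) (q i x))) ν)
    {x : E4} (hx : ∀ i, 16 * M i ≤ Kerr.radius (a i) (q i x)) (μ ν : Fin 4) :
    HasFDerivAt (fun y ↦ G y μ ν) (0 : E4 →L[ℝ] ℝ) x := by
  have hfun : (fun y ↦ G y μ ν) = fun y ↦
      Minkowski.bilin (E4.basisVector μ) (E4.basisVector ν) -
      ∑ i, Real.smoothTransition (2 - Kerr.radius (a i) (q i y) / (8 * M i)) *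
        (2 * Kerr.scalarH (M i) (a i) (q i y)) *
        ((Λ i : E4 ≃L[ℝ] E4) (Kerr.nullVector (a i) (q i y))) μ *
        ((Λ i : E4 ≃L[ℝ] E4) (Kerr.nullVector (a i) (q i y))) ν := funext fun y ↦ hG y μ ν
  rw [hfun]
  have hsum := HasFDerivAt.fun_sum (u := Finset.univ)
    fun i _ ↦ hasFDerivAt_term_zero (hM i) (Λ i) (p i) (hq i) (hx i) μ ν
  simp only [Finset.sum_const_zero] at hsum
  have h := hsum.const_sub (Minkowski.bilin (E4.basisVector μ) (E4.basisVector ν))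
  rw [neg_zero] at h
  exact h

/-- The flat value: where all `rᵢ ≥ 16Mᵢ`, `G^{μν} = η^{μν}`. [folklore] -/
theorem field_eq_minkowski_of_flat (hM : ∀ i, 0 < M i)
    (hG : ∀ x μ ν, G x μ ν = Minkowski.bilin (E4.basisVector μ) (E4.basisVector ν) -
      ∑ i, Real.smoothTransition (2 - Kerr.radius (a i) (q i x) / (8 * M i)) *
        (2 * Kerr.scalarH (M i) (a i) (q i x)) *
        ((Λ i : E4 ≃L[ℝ] E4) (Kerr.nullVector (a i) (q i x))) μ *
        ((Λ i : E4 ≃L[ℝ] E4) (Kerr.nullVector (a i) (q i x))) ν)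
    {x : E4} (hx : ∀ i, 16 * M i ≤ Kerr.radius (a i) (q i x)) (μ ν : Fin 4) :
    G x μ ν = Minkowski.bilin (E4.basisVector μ) (E4.basisVector ν) := by
  rw [hG, sub_eq_self]
  exact Finset.sum_eq_zero fun i _ ↦ by rw [coeff_eq_zero_of_le (hM i) (hx i), zero_mul, zero_mul]

/-! ### Stationarity of one centre; local single-centre form off the other zones -/

/-- Rest-frame coordinates of a point translated along the hole's 4-velocity `u = Λ e₀`:
`q(z + τu) = q(z) + τ e₀` (the world-line of the hole is the `t*`-axis of its rest frame;
O'Neill 1983, Ch. 9, p. 236). [folklore] -/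
theorem restFrame_add_smul (Λk : lorentzGroup) (pk : E3) {uk : E4} {qk : E4 → E4}
    (hu : uk = (Λk : E4 ≃L[ℝ] E4) (E4.basisVector 0))
    (hq : ∀ x, qk x = poincareInv Λk (E4.ofTimeSpace 0 pk) x) (τ : ℝ) (z : E4) :
    qk (z + τ • uk) = qk z + τ • E4.basisVector 0 := by
  rw [hq, hq, poincareInv, poincareInv, hu, add_sub_right_comm, map_add, map_smul,
    ContinuousLinearEquiv.symm_apply_apply]

/-- **The single-centre attenuated field is stationary along its hole's 4-velocity**:
`G_k(z + τ u_k) = G_k(z)` for `G_k = η⁻¹ − χ_k 2H_k (Λ_kℓ♯_k) ⊗ (Λ_kℓ♯_k)` (all Kerr–Schild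
components are `t*`-independent in the rest frame: `KerrSchildCoord`'s
`radius/scalarH/nullVector_add_smul_basisVector_zero`; Kerr–Schild 1965, §2). [folklore] -/
theorem single_add_smul {Mk ak : ℝ} (Λk : lorentzGroup) (pk : E3) {uk : E4} {qk : E4 → E4}
    (hu : uk = (Λk : E4 ≃L[ℝ] E4) (E4.basisVector 0))
    (hq : ∀ x, qk x = poincareInv Λk (E4.ofTimeSpace 0 pk) x) (τ : ℝ) (z : E4) :
    (fun (y : E4) (μ ν : Fin 4) ↦ Minkowski.bilin (E4.basisVector μ) (E4.basisVector ν) -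
      Real.smoothTransition (2 - Kerr.radius ak (qk y) / (8 * Mk)) *
        (2 * Kerr.scalarH Mk ak (qk y)) * ((Λk : E4 ≃L[ℝ] E4) (Kerr.nullVector ak (qk y))) μ *
        ((Λk : E4 ≃L[ℝ] E4) (Kerr.nullVector ak (qk y))) ν) (z + τ • uk) =
    (fun (y : E4) (μ ν : Fin 4) ↦ Minkowski.bilin (E4.basisVector μ) (E4.basisVector ν) -
      Real.smoothTransition (2 - Kerr.radius ak (qk y) / (8 * Mk)) *
        (2 * Kerr.scalarH Mk ak (qk y)) * ((Λk : E4 ≃L[ℝ] E4) (Kerr.nullVector ak (qk y))) μ *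
        ((Λk : E4 ≃L[ℝ] E4) (Kerr.nullVector ak (qk y))) ν) z := by
  funext μ ν
  simp only [restFrame_add_smul Λk pk hu hq, Kerr.radius_add_time_smul_basisVector,
    Kerr.scalarH_add_smul_basisVector_zero, Kerr.nullVector_add_smul_basisVector_zero]

/-- The rest-frame radius `y ↦ rᵢ(qᵢ y)` is continuous. [folklore] -/
theorem continuous_radius_restFrame {ai : ℝ} (Λi : lorentzGroup) (pi : E3) {qi : E4 → E4}
    (hq : ∀ x, qi x = poincareInv Λi (E4.ofTimeSpace 0 pi) x) :
    Continuous fun y ↦ Kerr.radius ai (qi y) := by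
  have hqf : qi = poincareInv Λi (E4.ofTimeSpace 0 pi) := funext hq
  rw [hqf]
  exact (Kerr.continuous_radius ai).comp (continuous_poincareInv Λi _)

/-- **Local single-centre form off the other zones**: at a point `x` with `rⱼ(qⱼ x) > 16Mⱼ` for
every `j ≠ k`, the patched field coincides on a neighbourhood of `x` with the single-centre
attenuated field of hole `k` (the other attenuated terms vanish identically nearby, by continuity
of the rest-frame radii). [folklore] -/
theorem eventually_eq_single (hM : ∀ i, 0 < M i)
    (hq : ∀ i x, q i x = poincareInv (Λ i) (E4.ofTimeSpace 0 (p i)) x)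
    (hG : ∀ x μ ν, G x μ ν = Minkowski.bilin (E4.basisVector μ) (E4.basisVector ν) -
      ∑ i, Real.smoothTransition (2 - Kerr.radius (a i) (q i x) / (8 * M i)) *
        (2 * Kerr.scalarH (M i) (a i) (q i x)) *
        ((Λ i : E4 ≃L[ℝ] E4) (Kerr.nullVector (a i) (q i x))) μ *
        ((Λ i : E4 ≃L[ℝ] E4) (Kerr.nullVector (a i) (q i x))) ν)
    (k : Fin N) {x : E4} (hk : ∀ j, j ≠ k → 16 * M j < Kerr.radius (a j) (q j x)) :
    ∀ᶠ y in 𝓝 x, ∀ μ ν, G y μ ν = Minkowski.bilin (E4.basisVector μ) (E4.basisVector ν) -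
      Real.smoothTransition (2 - Kerr.radius (a k) (q k y) / (8 * M k)) *
        (2 * Kerr.scalarH (M k) (a k) (q k y)) *
        ((Λ k : E4 ≃L[ℝ] E4) (Kerr.nullVector (a k) (q k y))) μ *
        ((Λ k : E4 ≃L[ℝ] E4) (Kerr.nullVector (a k) (q k y))) ν := by
  have hev : ∀ᶠ y in 𝓝 x, ∀ j, j ≠ k → 16 * M j < Kerr.radius (a j) (q j y) := by
    refine Filter.eventually_all.2 fun j ↦ ?_
    by_cases hjk : j = k
    · exact Filter.Eventually.of_forall fun y h ↦ absurd hjk h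
    · have hc := (continuous_radius_restFrame (ai := a j) (Λ j) (p j) (hq j)).continuousAt (x := x)
      exact (continuousAt_const.eventually_lt hc (hk j hjk)).mono fun y hy _ ↦ hy
  refine hev.mono fun y hy μ ν ↦ ?_
  rw [hG]
  congr 1
  refine Finset.sum_eq_single k (fun j _ hjk ↦ ?_) (fun h ↦ (h (Finset.mem_univ k)).elim)
  rw [coeff_eq_zero_of_le (hM j) (hy j hjk).le, zero_mul, zero_mul]

/-- **`∂_{u_k} G = 0` off the other zones**: at a point with `rⱼ(qⱼ x) > 16Mⱼ` for all `j ≠ k`,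
the derivative of every component of the patched field along the 4-velocity `u_k = Λ_k e₀` of
hole `k` vanishes (local single-centre form + stationarity of that form; no differentiability is
needed, `KerrSchild.fderiv_apply_eq_zero_of_invariant`). Consequently the Killing energy
`−ξ(u_k)` of a bicharacteristic is conserved while it avoids the other holes' closed zones
(O'Neill 1983, Ch. 9, Lemma 26). [folklore] -/
theorem fderiv_field_apply_u_eq_zero (hM : ∀ i, 0 < M i)
    (hu : ∀ i, u i = (Λ i : E4 ≃L[ℝ] E4) (E4.basisVector 0))
    (hq : ∀ i x, q i x = poincareInv (Λ i) (E4.ofTimeSpace 0 (p i)) x)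
    (hG : ∀ x μ ν, G x μ ν = Minkowski.bilin (E4.basisVector μ) (E4.basisVector ν) -
      ∑ i, Real.smoothTransition (2 - Kerr.radius (a i) (q i x) / (8 * M i)) *
        (2 * Kerr.scalarH (M i) (a i) (q i x)) *
        ((Λ i : E4 ≃L[ℝ] E4) (Kerr.nullVector (a i) (q i x))) μ *
        ((Λ i : E4 ≃L[ℝ] E4) (Kerr.nullVector (a i) (q i x))) ν)
    (k : Fin N) {x : E4} (hk : ∀ j, j ≠ k → 16 * M j < Kerr.radius (a j) (q j x)) (μ ν : Fin 4) :
    fderiv ℝ (fun y ↦ G y μ ν) x (u k) = 0 := by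
  have hev : (fun y ↦ G y μ ν) =ᶠ[𝓝 x] fun y ↦
      (fun (y : E4) (μ ν : Fin 4) ↦ Minkowski.bilin (E4.basisVector μ) (E4.basisVector ν) -
        Real.smoothTransition (2 - Kerr.radius (a k) (q k y) / (8 * M k)) *
          (2 * Kerr.scalarH (M k) (a k) (q k y)) *
          ((Λ k : E4 ≃L[ℝ] E4) (Kerr.nullVector (a k) (q k y))) μ *
          ((Λ k : E4 ≃L[ℝ] E4) (Kerr.nullVector (a k) (q k y))) ν) y μ ν :=
    (eventually_eq_single hM hq hG k hk).mono fun y hy ↦ hy μ ν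
  rw [hev.fderiv_eq]
  exact KerrSchild.fderiv_apply_eq_zero_of_invariant (K := u k)
    (G := fun (y : E4) (μ ν : Fin 4) ↦ Minkowski.bilin (E4.basisVector μ) (E4.basisVector ν) -
        Real.smoothTransition (2 - Kerr.radius (a k) (q k y) / (8 * M k)) *
          (2 * Kerr.scalarH (M k) (a k) (q k y)) *
          ((Λ k : E4 ≃L[ℝ] E4) (Kerr.nullVector (a k) (q k y))) μ *
          ((Λ k : E4 ≃L[ℝ] E4) (Kerr.nullVector (a k) (q k y))) ν)
    (fun τ z ↦ single_add_smul (Mk := M k) (ak := a k) (Λ k) (p k) (hu k) (hq k) τ z) x μ ν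

end Field

end Summit.FinalStateConjecture.FinalStateConjecture.Theorems.RecedingDoppler

end
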